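import Summits.BirchSwinnertonDyer.Rank1Residual.GaloisImage.PropagatedStructure
import Literature.NumberTheory.GaloisRepresentations.LocalHOneInertiaRestrictionProfinite
import Literature.NumberTheory.EllipticCurves.TateModuleProjSurjectiveProofs
import Literature.NumberTheory.EllipticCurves.GaloisActionProofs
import Literature.NumberTheory.Automorphic.AdicCompletionLocalField
import HarnessLib

/-!
# The E-free LOCAL INDEX LEMMA at Kolyvagin-system level for `T = T_p E|_{Γ_{ℚ_w}}`:
# `0 → H¹_ur(ℚ_w, T) → H¹(ℚ_w, T) → H¹(I_w, T)^{Fr} → 0` with both ends explicit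
# (cell `bsd-addord`, seat w2-acc5 gen 3; route W2 `KimAtThreeKolyvagin`, item 19562
# `DeepUpperAtThreeOffKatoStratum`, the off-stratum `3 ∣ ∏ c_ℓ` rows — TamDiv∞ local algebra)

HONEST FRAMING: TOOL theorems of continuous Galois cohomology, instantiated at the `p`-adic Tate module
of an elliptic curve over `ℚ` (any `p`, any finite place `w`); no definition, no named fact, no
`sorry`; closes nothing by itself; nothing is booked; BSD is not proved by any of this.  This is the
E-FREE part of the local index that governs the Tamagawa defect of an Euler system at a bad place
(Mazur–Rubin, *Kolyvagin systems*, Remark A.5: Kato's classes land in `H¹_{𝓕_u} ⊆ H¹_{𝓕can}`;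
Büyükboduk, JNT 129 (2009) §2.1.2 + Remark 2 + Thm. 3.1: the index
`[H¹_{𝓕can}(ℚ_ℓ, T) : H¹_{𝓕u}(ℚ_ℓ, T)]` is the `p`-part of `c_ℓ`; Rubin, *Euler Systems*,
Lemma 1.3.2 / 1.3.5), asked for by the planner (HOME STATUS l.982 ANSWER (a), consumer: w2-tamdiv's
TamDiv∞ on item 19562).  The E-SPECIFIC order `#H¹(I_w, T_pE)^{Fr} = (c_w)_p` is NOT here.

## What

For `W/ℚ` elliptic, a prime `p`, a place `v` of `ℚ`, `T := tateLocalRep W p v` (`T_pE|_{Γ_{ℚ_v}}`, the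
n1011 object behind `propagatedSelmerStructure`):

* §1 `exists_discreteTowerPresentation_tate_restrictField`, `exists_discreteTowerPresentation_tateLocalRep`
  — **`T_pE = lim E[p^{i+1}]`** as a finite-level `DiscreteTowerPresentation` of `T_pE|_{Γ_L}` for any field
  `L ⊇ ℚ`, in particular of `(tateLocalRep W p v).toTopRep` (levels the tree's local torsion modules
  `((W.torsionGaloisModule (p^i·p)).toLocal v).toTopRep`, projections `tateToTorsion W p i`, transitions
  `P ↦ p • P`, surjective by `nsmul_geomPoints_surjective`); any place `v`.
* §2 at a FINITE place `w` (`F = ℚ_w = w.adicCompletion ℚ`, `I_w = absInertia F`, `φ` any arithmetic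
  Frobenius lift, `IsFrobPow φ 1`), from the Literature package
  `LocalHOneInertiaRestrictionProfinite` / `HOneRestrictionOntoInvariants` / `HOneUnramifiedProcyclic`:
  - **`exists_resSubgroup_inertia_eq_of_conjMap_eq`**, `exists_resSubgroup_inertia_eq_iff_forall_conjMap_eq`
    — `H¹(ℚ_w, T_pE) ↠ H¹(I_w, T_pE)^{Fr}`: every Frobenius-invariant class of `H¹(I_w, T_pE)` is a
    restriction (`cd Ẑ = 1`, realised by an explicit cocycle extension along `Γ_{ℚ_w} = I_w ⋊ cl⟨φ⟩`);
  - **`exists_vanishing_apply_eq_inertia`** — every `t ∈ T_pE^{I_w}` is `z(φ)` for an `I_w`-vanishing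
    continuous cocycle `z` of `Γ_{ℚ_w}` (an unramified class);
  - **`oneCocycleClass_eq_iff_of_vanishing_inertia`**, `oneCocycleClass_eq_zero_iff_of_vanishing_inertia`
    — two `I_w`-vanishing cocycles have the same class iff their values at `φ` differ by `(φ − 1)v`,
    `v ∈ T_pE^{I_w}`;  `exists_rep_vanishing_inertia` — unramified classes have `I_w`-vanishing,
    `T^{I_w}`-valued representatives.
  Together: **`H¹_ur(ℚ_w, T_pE) = ker(res_{I_w}) ≅ T_pE^{I_w}/(Fr − 1)T_pE^{I_w}`** and
  **`H¹(ℚ_w, T_pE)/H¹_ur(ℚ_w, T_pE) ≅ H¹(I_w, T_pE)^{Fr}`** — the exact sequence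
  `0 → H¹(ℚ_w^nr/ℚ_w, T^{I_w}) → H¹(ℚ_w, T) → H¹(I_w, T)^{Fr} → 0` in n1011's currency
  (`tateLocalRep`, `contOneCocycles`, `resSubgroup`, `conjMap`).
* §3 (appended) `oneCocycleClass_mem_propagatedSelmerStructure_of_[forall_]vanishing_inertia` —
  **`𝓕_u(w) ⊆ 𝓕_can(w)` on cocycles**, every `p`, `k`, `w`: an `I_w`-vanishing cocycle of `E[p^k · p]` whose
  value at `φ` lifts to `T_pE^{I_w}` has class in `propagatedSelmerStructure W p k (Sum.inr w)`.

References: K. Rubin, *Euler Systems* (2000), Lemma 1.3.2, Lemma 1.3.5, App. B §2; B. Mazur, K. Rubin,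
Mem. AMS 799 (2004), Remark A.5; K. Büyükboduk, J. Number Theory 129 (2009) §2.1.2, Thm. 3.1;
J.-P. Serre, *Local Fields*, XIII §1; Neukirch–Schmidt–Wingberg (2008), (1.6.7), (2.7.5), Thm. 7.5.3.
-/

noncomputable section

-- the cell's Theorems namespace `Summit.BirchSwinnertonDyer.BirchSwinnertonDyer.…` repeats the summit name by design (D-0017)
set_option linter.dupNamespace false

open CategoryTheory Function Field NumberField IsDedekindDomain
open scoped NumberField Classical Pointwise
open WeierstrassCurve Literature.NumberTheory.EllipticCurves Literature.NumberTheory.GaloisRepresentations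
open Summit.BirchSwinnertonDyer.Rank1Residual.GaloisImage

namespace Summit.BirchSwinnertonDyer.BirchSwinnertonDyer.Theorems.KimAtThreeDeepUpperOffStratumLocalIndex

variable (W : WeierstrassCurve ℚ) [W.IsElliptic] (p : ℕ) [hp : Fact p.Prime]

/-! ### §1 `T_pE|_{Γ_{ℚ_v}}` is presented by the tower `E[p] ← E[p²] ← ⋯` -/

omit [W.IsElliptic] hp in
/-- `p • P ∈ E[p^i · p]` for `P ∈ E[p^{i+1} · p]`. [folklore] -/
theorem zsmul_mem_geomTorsion_level (i : ℕ) {P : geomPoints W}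
    (hP : P ∈ geomTorsion W ((p : ℤ) ^ (i + 1) * (p : ℤ))) :
    (p : ℤ) • P ∈ geomTorsion W ((p : ℤ) ^ i * (p : ℤ)) := by
  rw [mem_geomTorsion_iff] at hP ⊢
  rw [smul_smul, ← pow_succ, hP]

/-- **`T_pE|_{Γ_L} = lim_i E[p^{i+1}]` as a finite-level tower of discrete `Γ_L`-modules**, for any
field `L ⊇ ℚ`: the restricted Tate module `(T_pE)|_{Γ_L}` admits a `DiscreteTowerPresentation`
(Neukirch–Schmidt–Wingberg II §7) whose levels are the restricted torsion modules `E[p^i · p]|_{Γ_L}`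
(finite), with projections `π_{i+1} = tateToTorsion W p i` and transitions `P ↦ p • P` (onto: `[p]`
is onto `E(ℚ̄)`). Silverman, *AEC*, III §7. [cite: NeukirchSchmidtWingberg2008, II §7 (2.7.5)] -/
theorem exists_discreteTowerPresentation_tate_restrictField (L : Type) [Field L] [Algebra ℚ L] :
    ∃ P : DiscreteTowerPresentation
      (GaloisRep.restrictField L (W.tateGaloisRep p (W.continuous_galoisRepTate_holds p)).toIntRep).toTopRep,
      ∀ i, Finite (P.obj i) := by
  have hp0 : (p : ℤ) ≠ 0 := by exact_mod_cast hp.out.ne_zero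
  have hlev : ∀ i : ℕ, ((p : ℤ) ^ i * (p : ℤ)) ≠ 0 := fun i => mul_ne_zero (pow_ne_zero _ hp0) hp0
  -- the transition `P ↦ p • P : E[p^{i+1}·p] → E[p^i·p]`
  let trHom : ∀ i : ℕ, geomTorsion W ((p : ℤ) ^ (i + 1) * (p : ℤ)) →+
      geomTorsion W ((p : ℤ) ^ i * (p : ℤ)) := fun i =>
    ((zsmulAddGroupHom (α := geomPoints W) (p : ℤ)).comp
      (geomTorsion W ((p : ℤ) ^ (i + 1) * (p : ℤ))).subtype).codRestrict _
        fun P => zsmul_mem_geomTorsion_level W p i P.2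
  have htrHom : ∀ (i : ℕ) (P : geomTorsion W ((p : ℤ) ^ (i + 1) * (p : ℤ))),
      ((trHom i P : geomTorsion W ((p : ℤ) ^ i * (p : ℤ))) : geomPoints W) = (p : ℤ) • (P : geomPoints W) :=
    fun _ _ => rfl
  let tr : ∀ i : ℕ,
      DiscreteGaloisModule.toTopRep (GaloisRep.restrictField L (W.torsionGaloisModule ((p : ℤ) ^ (i + 1) * (p : ℤ)))) ⟶
      DiscreteGaloisModule.toTopRep (GaloisRep.restrictField L (W.torsionGaloisModule ((p : ℤ) ^ i * (p : ℤ)))) :=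
    fun i =>
    TopRep.ofHom ⟨⟨(trHom i).toIntLinearMap, continuous_of_discreteTopology⟩, fun σ =>
      ContinuousLinearMap.ext fun P => Subtype.ext (by
        change (p : ℤ) • ((GaloisRep.restrictField L (W.torsionGaloisModule ((p : ℤ) ^ (i + 1) * (p : ℤ))) σ P :
            geomTorsion W _) : geomPoints W) =
          absGaloisRestrict ℚ L σ • ((p : ℤ) • (P : geomPoints W))
        rw [GaloisRep.restrictField_apply, torsionGaloisModule_apply_apply,
          Literature.NumberTheory.EllipticCurves.AddSubgroup.torsionBy.coe_smul, smul_zsmul_geomPoints])⟩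
  let proj : ∀ i : ℕ,
      (GaloisRep.restrictField L (W.tateGaloisRep p (W.continuous_galoisRepTate_holds p)).toIntRep).toTopRep ⟶
      DiscreteGaloisModule.toTopRep (GaloisRep.restrictField L (W.torsionGaloisModule ((p : ℤ) ^ i * (p : ℤ)))) :=
    fun i =>
    TopRep.ofHom ⟨⟨(tateToTorsion W p i).toIntLinearMap, continuous_tateToTorsion W p i⟩,
      fun _ => ContinuousLinearMap.ext fun _ => Subtype.ext rfl⟩
  refine ⟨{ obj := fun i =>
              DiscreteGaloisModule.toTopRep (GaloisRep.restrictField L (W.torsionGaloisModule ((p : ℤ) ^ i * (p : ℤ))))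
            tr := tr
            proj := proj
            tr_proj := fun i x => Subtype.ext ?_
            discrete := fun i => ?_
            continuous_action := fun i =>
              (GaloisRep.restrictField L (W.torsionGaloisModule ((p : ℤ) ^ i * (p : ℤ)))).continuous_smul
            tr_surjective := fun i => ?_
            proj_injective := fun x y h => ?_
            proj_lift := fun s hs => ?_
            isInducing := ?_ }, fun i => ?_⟩
  · -- `p • x_{i+2} = x_{i+1}`
    change (p : ℤ) • TateModule.proj p (i + 1 + 1) x = TateModule.proj p (i + 1) x
    rw [natCast_zsmul, TateModule.smul_proj_succ]
  · change DiscreteTopology (geomTorsion W ((p : ℤ) ^ i * (p : ℤ)))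
    infer_instance
  · -- `[p]` is onto
    intro Q
    obtain ⟨P, hP⟩ := W.nsmul_geomPoints_surjective hp.out.ne_zero (Q : geomPoints W)
    have hP' : (p : ℤ) • P = (Q : geomPoints W) := by
      have h : p • P = (Q : geomPoints W) := hP
      rw [← h, natCast_zsmul]
    have hQ : ((p : ℤ) ^ i * (p : ℤ)) • (Q : geomPoints W) = 0 := (mem_geomTorsion_iff W _ _).mp Q.2
    have hPmem : P ∈ geomTorsion W ((p : ℤ) ^ (i + 1) * (p : ℤ)) := by
      rw [mem_geomTorsion_iff, show (p : ℤ) ^ (i + 1) * (p : ℤ) = ((p : ℤ) ^ i * (p : ℤ)) * (p : ℤ) by ring,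
        mul_smul, hP', hQ]
    exact ⟨⟨P, hPmem⟩, Subtype.ext hP'⟩
  · -- jointly injective
    refine TateModule.ext fun n => ?_
    cases n with
    | zero =>
      have h0 : ∀ z : W.tateModule p, TateModule.proj p 0 z = 0 := fun z => by
        have := TateModule.pow_smul_proj 0 z; rwa [pow_zero, one_smul] at this
      rw [h0, h0]
    | succ i => exact congrArg Subtype.val (h i)
  · -- every compatible family lifts
    refine ⟨TateModule.mk (fun n => match n with | 0 => 0 | i + 1 => (s i : geomPoints W)) (fun n => ?_)
      (fun n => ?_), fun i => Subtype.ext (by rfl)⟩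
    · cases n with
      | zero => exact smul_zero _
      | succ i =>
        change p ^ (i + 1) • (s i : geomPoints W) = 0
        have h : ((p : ℤ) ^ i * (p : ℤ)) • (s i : geomPoints W) = 0 := (mem_geomTorsion_iff W _ _).mp (s i).2
        rw [← natCast_zsmul]
        push_cast
        convert h using 2
        ring
    · cases n with
      | zero =>
        change p • (s 0 : geomPoints W) = 0
        have h : ((p : ℤ) ^ 0 * (p : ℤ)) • (s 0 : geomPoints W) = 0 := (mem_geomTorsion_iff W _ _).mp (s 0).2
        rw [← natCast_zsmul]
        convert h using 2
        ring
      | succ i =>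
        change p • (s (i + 1) : geomPoints W) = (s i : geomPoints W)
        have h := congrArg Subtype.val (hs i)
        rw [← natCast_zsmul]; exact h
  · -- the topology of `T_pE` is induced by the projections
    let F : W.tateModule p → ∀ i : ℕ, geomTorsion W ((p : ℤ) ^ i * (p : ℤ)) := fun x i => tateToTorsion W p i x
    let ι : (∀ i : ℕ, geomTorsion W ((p : ℤ) ^ i * (p : ℤ))) → (ℕ → geomPoints W) := fun t n =>
      match n with | 0 => 0 | i + 1 => (t i : geomPoints W)
    have hF : Continuous F := continuous_pi fun i => continuous_tateToTorsion W p i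
    have hι : Continuous ι := by
      refine continuous_pi fun n => ?_
      cases n with
      | zero => exact continuous_const
      | succ i => exact continuous_subtype_val.comp (continuous_apply i)
    have hιF : ι ∘ F = fun x : W.tateModule p => (x.1 : ℕ → geomPoints W) := by
      funext x; funext n
      cases n with
      | zero =>
        change (0 : geomPoints W) = TateModule.proj p 0 x
        have := TateModule.pow_smul_proj 0 x; rw [pow_zero, one_smul] at this
        exact this.symm
      | succ i => rfl
    refine ⟨le_antisymm (continuous_iff_le_induced.mp hF) ?_⟩
    calc TopologicalSpace.induced F inferInstance
        ≤ TopologicalSpace.induced F (TopologicalSpace.induced ι inferInstance) :=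
          induced_mono (continuous_iff_le_induced.mp hι)
      _ = TopologicalSpace.induced (ι ∘ F) inferInstance := induced_compose
      _ = TopologicalSpace.induced (fun x : W.tateModule p => (x.1 : ℕ → geomPoints W)) inferInstance := by
          rw [hιF]
      _ = _ := rfl
  · change Finite (geomTorsion W ((p : ℤ) ^ i * (p : ℤ)))
    exact finite_torsionPoints_holds W (AlgebraicClosure ℚ) (hlev i)

/-- **`T_pE|_{Γ_{ℚ_v}} = lim_i E[p^{i+1}]`** for the n1011 object `tateLocalRep W p v` at any place `v` of
`ℚ` (levels `((W.torsionGaloisModule (p^i · p)).toLocal v).toTopRep`, the local modules of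
`propagatedSelmerStructure`). [cite: NeukirchSchmidtWingberg2008, II §7 (2.7.5)] -/
theorem exists_discreteTowerPresentation_tateLocalRep (v : Place ℚ) :
    ∃ P : DiscreteTowerPresentation (tateLocalRep W p v).toTopRep, ∀ i, Finite (P.obj i) :=
  exists_discreteTowerPresentation_tate_restrictField W p (Place.Completion v)

/-! ### §2 The local index sequence at a finite place `w` -/

section Local

variable (w : HeightOneSpectrum (𝓞 ℚ))

/-- Local notation: `T_pE|_{Γ_{ℚ_w}}` as a continuous `ℤ`-linear representation of `Γ_{ℚ_w}`,
`ℚ_w = w.adicCompletion ℚ` (this IS `tateLocalRep W p (Sum.inr w)`, by `rfl`). -/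
local notation3 "𝕋" => (GaloisRep.restrictField (HeightOneSpectrum.adicCompletion ℚ w)
  (WeierstrassCurve.tateGaloisRep W p (W.continuous_galoisRepTate_holds p)).toIntRep)

omit [W.IsElliptic] in
/-- The joint continuity of the action of `Γ_{ℚ_w}` on `T_pE`. [folklore] -/
theorem continuous_action_tate_adicCompletion :
    Continuous fun q : absoluteGaloisGroup (w.adicCompletion ℚ) × W.tateModule p => (𝕋).toTopRep.ρ q.1 q.2 :=
  (𝕋).continuous_smul

/-- **`H¹(ℚ_w, T_pE) ↠ H¹(I_w, T_pE)^{Fr}`**: for a finite place `w` of `ℚ` (`ℚ_w = w.adicCompletion ℚ`,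
inertia group `I_w = absInertia ℚ_w`), a prime `p` (ANY, also `w ∣ p`) and an arithmetic Frobenius lift
`φ ∈ Γ_{ℚ_w}` (`IsFrobPow φ 1`): every class of `H¹(I_w, T_pE)` fixed by `φ` is the restriction of a class
of `H¹(ℚ_w, T_pE)` — the right end of `0 → H¹(ℚ_w^nr/ℚ_w, T_pE^{I_w}) → H¹(ℚ_w, T_pE) → H¹(I_w, T_pE)^{Fr} → 0`
(for `tateLocalRep W p (Sum.inr w) = 𝕋`).
[cite: Rubin2000, Lemma 1.3.2] [cite: NeukirchSchmidtWingberg2008, (1.6.7)] -/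
theorem exists_resSubgroup_inertia_eq_of_conjMap_eq
    {φ : absoluteGaloisGroup (w.adicCompletion ℚ)} (hφ : IsFrobPow φ 1)
    (yc : continuousCohomology 1 (subgroupRep (𝕋).toTopRep (absInertia (w.adicCompletion ℚ))))
    (hinv : haveI : (absInertia (w.adicCompletion ℚ)).Normal := absInertia_normal_holds _
      conjMap (𝕋).toTopRep (absInertia (w.adicCompletion ℚ)) φ 1 yc = yc) :
    ∃ xc : continuousCohomology 1 (𝕋).toTopRep,
      resSubgroup (𝕋).toTopRep (absInertia (w.adicCompletion ℚ)) 1 xc = yc := by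
  haveI : T2Space (W.tateModule p) := TateModule.t2Space
  obtain ⟨P, hP⟩ := exists_discreteTowerPresentation_tate_restrictField W p (w.adicCompletion ℚ)
  exact exists_resSubgroup_absInertia_eq_of_conjMap_eq_of_tower (w.adicCompletion ℚ) (𝕋).toTopRep
    (continuous_action_tate_adicCompletion W p w) P hP hφ yc hinv

/-- **`range (H¹(ℚ_w, T_pE) → H¹(I_w, T_pE)) = H¹(I_w, T_pE)^{Γ_{ℚ_w}}`**: a class of `H¹(I_w, T_pE)` is
restricted from `Γ_{ℚ_w}` iff it is `Γ_{ℚ_w}`-invariant, i.e. `H¹(ℚ_w, T)/H¹_ur(ℚ_w, T) ≅ H¹(I_w, T)^{Fr}`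
(the E-free half of the local index `[H¹_f : H¹_ur] = #H¹(I_w, T)^{Fr}_{tors}`, Rubin Lemma 1.3.5).
[cite: Rubin2000, Lemma 1.3.2] [cite: NeukirchSchmidtWingberg2008, (1.6.7)] -/
theorem exists_resSubgroup_inertia_eq_iff_forall_conjMap_eq
    (yc : continuousCohomology 1 (subgroupRep (𝕋).toTopRep (absInertia (w.adicCompletion ℚ)))) :
    (∃ xc : continuousCohomology 1 (𝕋).toTopRep,
      resSubgroup (𝕋).toTopRep (absInertia (w.adicCompletion ℚ)) 1 xc = yc) ↔
      ∀ g : absoluteGaloisGroup (w.adicCompletion ℚ),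
        haveI : (absInertia (w.adicCompletion ℚ)).Normal := absInertia_normal_holds _
        conjMap (𝕋).toTopRep (absInertia (w.adicCompletion ℚ)) g 1 yc = yc := by
  haveI : T2Space (W.tateModule p) := TateModule.t2Space
  obtain ⟨P, hP⟩ := exists_discreteTowerPresentation_tate_restrictField W p (w.adicCompletion ℚ)
  exact exists_resSubgroup_absInertia_eq_iff_forall_conjMap_eq_of_tower (w.adicCompletion ℚ) (𝕋).toTopRep
    (continuous_action_tate_adicCompletion W p w) P hP yc

/-- **`H¹_ur(ℚ_w, T_pE) ↠ T_pE^{I_w}/(Fr − 1)T_pE^{I_w}`**: every `I_w`-invariant `t ∈ T_pE` is the value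
at the Frobenius lift `φ` of a continuous cocycle of `Γ_{ℚ_w}` VANISHING on `I_w` (an unramified class).
[cite: SerreLocalFields1979, XIII §1 Prop. 1] [cite: Rubin2000, Lemma 1.3.2] -/
theorem exists_vanishing_apply_eq_inertia
    {φ : absoluteGaloisGroup (w.adicCompletion ℚ)} (hφ : IsFrobPow φ 1) {t : W.tateModule p}
    (ht : ∀ n : absInertia (w.adicCompletion ℚ),
      (𝕋).toTopRep.ρ (n : absoluteGaloisGroup (w.adicCompletion ℚ)) t = t) :
    ∃ z : contOneCocycles (𝕋).toTopRep,
      (∀ n : absInertia (w.adicCompletion ℚ), z.1 n = 0) ∧ z.1 φ = t := by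
  haveI : T2Space (W.tateModule p) := TateModule.t2Space
  obtain ⟨P, hP⟩ := exists_discreteTowerPresentation_tate_restrictField W p (w.adicCompletion ℚ)
  exact exists_vanishing_apply_eq_absInertia_of_tower (w.adicCompletion ℚ) (𝕋).toTopRep P hP hφ ht

omit [W.IsElliptic] in
/-- **`H¹_ur(ℚ_w, T_pE) ↪ T_pE^{I_w}/(Fr − 1)T_pE^{I_w}`**: two `I_w`-vanishing continuous cocycles of
`Γ_{ℚ_w}` with values in `T_pE` have the same class iff their values at `φ` differ by `(φ − 1)v` with
`v ∈ T_pE^{I_w}`. [cite: SerreLocalFields1979, XIII §1 Prop. 1] [cite: Rubin2000, Lemma 1.3.2] -/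
theorem oneCocycleClass_eq_iff_of_vanishing_inertia
    {φ : absoluteGaloisGroup (w.adicCompletion ℚ)} (hφ : IsFrobPow φ 1)
    (z z' : contOneCocycles (𝕋).toTopRep)
    (hz : ∀ n : absInertia (w.adicCompletion ℚ), z.1 n = 0)
    (hz' : ∀ n : absInertia (w.adicCompletion ℚ), z'.1 n = 0) :
    oneCocycleClass _ z = oneCocycleClass _ z' ↔
      ∃ v : W.tateModule p, (∀ n : absInertia (w.adicCompletion ℚ),
        (𝕋).toTopRep.ρ (n : absoluteGaloisGroup (w.adicCompletion ℚ)) v = v) ∧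
        z.1 φ - z'.1 φ = (𝕋).toTopRep.ρ φ v - v := by
  haveI : T2Space (W.tateModule p) := TateModule.t2Space
  exact oneCocycleClass_eq_iff_of_vanishing_absInertia (w.adicCompletion ℚ) (𝕋).toTopRep
    (continuous_action_tate_adicCompletion W p w) hφ z z' hz hz'

omit [W.IsElliptic] in
/-- In particular an `I_w`-vanishing cocycle with values in `T_pE` has trivial class iff its value at
`φ` lies in `(φ − 1)T_pE^{I_w}`. [cite: SerreLocalFields1979, XIII §1 Prop. 1] -/
theorem oneCocycleClass_eq_zero_iff_of_vanishing_inertia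
    {φ : absoluteGaloisGroup (w.adicCompletion ℚ)} (hφ : IsFrobPow φ 1)
    (z : contOneCocycles (𝕋).toTopRep)
    (hz : ∀ n : absInertia (w.adicCompletion ℚ), z.1 n = 0) :
    oneCocycleClass _ z = 0 ↔
      ∃ v : W.tateModule p, (∀ n : absInertia (w.adicCompletion ℚ),
        (𝕋).toTopRep.ρ (n : absoluteGaloisGroup (w.adicCompletion ℚ)) v = v) ∧
        z.1 φ = (𝕋).toTopRep.ρ φ v - v := by
  haveI : T2Space (W.tateModule p) := TateModule.t2Space
  exact oneCocycleClass_eq_zero_iff_of_vanishing_absInertia (w.adicCompletion ℚ) (𝕋).toTopRep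
    (continuous_action_tate_adicCompletion W p w) hφ z hz

omit [W.IsElliptic] in
/-- **Unramified representatives**: a class of `H¹(ℚ_w, T_pE)` killed by restriction to `I_w` is
represented by an `I_w`-vanishing cocycle with `T_pE^{I_w}`-values.
[cite: SerreGaloisCohomology1997, I §2.6 (b)] -/
theorem exists_rep_vanishing_inertia
    (c : continuousCohomology 1 (𝕋).toTopRep)
    (hc : resSubgroup (𝕋).toTopRep (absInertia (w.adicCompletion ℚ)) 1 c = 0) :
    ∃ z : contOneCocycles (𝕋).toTopRep, oneCocycleClass _ z = c ∧
      (∀ n : absInertia (w.adicCompletion ℚ), z.1 n = 0) ∧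
      ∀ (g : absoluteGaloisGroup (w.adicCompletion ℚ)) (n : absInertia (w.adicCompletion ℚ)),
        (𝕋).toTopRep.ρ (n : absoluteGaloisGroup (w.adicCompletion ℚ)) (z.1 g) = z.1 g :=
  exists_rep_vanishing_absInertia_of_resSubgroup_eq_zero (w.adicCompletion ℚ) (𝕋).toTopRep
    (continuous_action_tate_adicCompletion W p w) c hc

/-- The objects of §2 are those of n1011's `tateLocalRep` at the finite place `Sum.inr w`:
`tateLocalRep W p (Sum.inr w) = T_pE|_{Γ_{ℚ_w}}` definitionally (`Place.Completion (Sum.inr w)` is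
`w.adicCompletion ℚ`). [folklore] -/
theorem tateLocalRep_inr_eq :
    tateLocalRep W p (Sum.inr w) = (𝕋) := rfl

end Local

/-! ### §3 `𝓕_u(w) ⊆ 𝓕_can(w)` on cocycles (w2-tamdiv's local lemma (L), all `p`, `k`, `w`) -/

section Propagated

variable (k : ℕ) (w : HeightOneSpectrum (𝓞 ℚ))

/-- Local notation: `T_pE|_{Γ_{ℚ_w}}` (= `tateLocalRep W p (Sum.inr w)`). -/
local notation3 "𝕋" => (GaloisRep.restrictField (HeightOneSpectrum.adicCompletion ℚ w)
  (WeierstrassCurve.tateGaloisRep W p (W.continuous_galoisRepTate_holds p)).toIntRep)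
/-- Local notation: `E[p^k · p]|_{Γ_{ℚ_w}}` (= `(W.torsionGaloisModule (p^k · p)).toLocal (Sum.inr w)`). -/
local notation3 "𝕄" => (GaloisRep.restrictField (HeightOneSpectrum.adicCompletion ℚ w)
  (W.torsionGaloisModule ((p : ℤ) ^ k * (p : ℤ))))

/-- **`𝓕_u(w) ⊆ 𝓕_can(w)` on cocycles** (Mazur–Rubin Remark A.5's propagated unramified condition lies
in the canonical one; w2-tamdiv's local lemma (L)).  For a prime `p`, a depth `k`, a finite place `w` of
`ℚ` and an arithmetic Frobenius lift `φ ∈ Γ_{ℚ_w}` (`IsFrobPow φ 1`): if a continuous cocycle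
`ψ : Γ_{ℚ_w} → E[p^k · p]` VANISHES on the inertia group `I_w = absInertia ℚ_w` and `ψ(φ) = π_{k+1}(t)`
for some `t ∈ T_pE^{I_w}`, then `[ψ] ∈ propagatedSelmerStructure W p k (Sum.inr w)`
(`= im(H¹(ℚ_w, T_pE) → H¹(ℚ_w, E[p^k · p]))`): `[ψ] = π_{k+1,*}[z]` for the `I_w`-vanishing `T_pE`-cocycle
`z` with `z(φ) = t`, an `I_w`-vanishing cocycle being determined up to a coboundary by its value at `φ`.
Every `p` and `k`; no stable-range detour. [cite: MazurRubin2004, App. A Remark A.5] [cite: Rubin2000, Lemma 1.3.2] -/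
theorem oneCocycleClass_mem_propagatedSelmerStructure_of_vanishing_inertia
    {φ : absoluteGaloisGroup (w.adicCompletion ℚ)} (hφ : IsFrobPow φ 1)
    (ψ : contOneCocycles (DiscreteGaloisModule.toTopRep 𝕄))
    (hψI : ∀ n : absInertia (w.adicCompletion ℚ), ψ.1 n = 0)
    (hψφ : ∃ t : W.tateModule p,
      (∀ n : absInertia (w.adicCompletion ℚ), (𝕋).toTopRep.ρ (n : absoluteGaloisGroup (w.adicCompletion ℚ)) t = t) ∧
        ((ψ.1 φ : geomTorsion W ((p : ℤ) ^ k * (p : ℤ))) : geomPoints W) = TateModule.proj p (k + 1) t) :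
    oneCocycleClass _ ψ ∈ propagatedSelmerStructure W p k (Sum.inr w) := by
  obtain ⟨t, ht, hψt⟩ := hψφ
  obtain ⟨z, hzI, hzφ⟩ := exists_vanishing_apply_eq_inertia W p w hφ ht
  -- the push-forward `ζ = π_{k+1} ∘ z` vanishes on `I_w` and agrees with `ψ` at `φ`
  let ζ : contOneCocycles (DiscreteGaloisModule.toTopRep 𝕄) := pushCocycle W p k (Sum.inr w) z
  have hζ : ∀ g, ζ.1 g = tateToTorsion W p k (z.1 g) := fun g => rfl
  have hζI : ∀ n : absInertia (w.adicCompletion ℚ), ζ.1 n = 0 := fun n => by rw [hζ, hzI n, map_zero]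
  have hψζ : ψ.1 φ = ζ.1 φ := Subtype.ext (by rw [hψt, hζ, hzφ]; rfl)
  have hcl : oneCocycleClass _ ψ = oneCocycleClass _ ζ := by
    rw [oneCocycleClass_eq_iff_of_vanishing_absInertia (w.adicCompletion ℚ) (DiscreteGaloisModule.toTopRep 𝕄)
      (𝕄).continuous_smul hφ ψ ζ hψI hζI]
    exact ⟨0, fun _ => map_zero _, by rw [map_zero, sub_zero, sub_eq_zero, hψζ]⟩
  have key : oneCocycleClass _ ζ ∈ propagatedSelmerStructure W p k (Sum.inr w) :=
    (mem_propagatedSelmerStructure_iff W p k (Sum.inr w) _).mpr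
      ⟨oneCocycleClass _ z, tateLocalMap_oneCocycleClass W p k (Sum.inr w) z⟩
  rw [hcl]
  exact key

/-- **`𝓕_u(w) ⊆ 𝓕_can(w)`, THEOREM B-u form.** If a continuous cocycle `ψ : Γ_{ℚ_w} → E[p^k · p]`
vanishes on `I_w` and takes ALL its values in `π_{k+1}(T_pE^{I_w})` (the conclusion shape of THEOREM B-u
`KimAtThreeDeepUpperBadPlaceDescent.exists_rep_apply_eq_red_invariant_of_unramified` pulled back along
`absGaloisRestrict`), then `[ψ] ∈ propagatedSelmerStructure W p k (Sum.inr w)`, every `p` and `k`.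
[cite: MazurRubin2004, App. A Remark A.5] [cite: Rubin2000, Lemma 1.3.2] -/
theorem oneCocycleClass_mem_propagatedSelmerStructure_of_forall_vanishing_inertia
    (ψ : contOneCocycles (DiscreteGaloisModule.toTopRep 𝕄))
    (hψI : ∀ n : absInertia (w.adicCompletion ℚ), ψ.1 n = 0)
    (hψD : ∀ g : absoluteGaloisGroup (w.adicCompletion ℚ), ∃ t : W.tateModule p,
      (∀ n : absInertia (w.adicCompletion ℚ), (𝕋).toTopRep.ρ (n : absoluteGaloisGroup (w.adicCompletion ℚ)) t = t) ∧
        ((ψ.1 g : geomTorsion W ((p : ℤ) ^ k * (p : ℤ))) : geomPoints W) = TateModule.proj p (k + 1) t) :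
    oneCocycleClass _ ψ ∈ propagatedSelmerStructure W p k (Sum.inr w) := by
  obtain ⟨φ, hφ⟩ := exists_isFrobPow_holds (F := w.adicCompletion ℚ) 1
  exact oneCocycleClass_mem_propagatedSelmerStructure_of_vanishing_inertia W p k w hφ ψ hψI (hψD φ)

end Propagated

end Summit.BirchSwinnertonDyer.BirchSwinnertonDyer.Theorems.KimAtThreeDeepUpperOffStratumLocalIndex

end
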